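import Literature.AlgebraicGeometry.Frobenioids.BaseIdentityPreStepsSlim
import HarnessLib

/-!
# Frobenioids I, Prop. 3.3 (i), forward half, as the schema `Prop33i_forward S A`: the universal closure
# over ARBITRARY pre-Frobenioid operations `S` is false (FACT-LIST F-0915)

Mochizuki, *The geometry of Frobenioids I: the general theory*, Kyushu J. Math. **62** (2008) 293–400,
§3, Proposition 3.3 (i), kurims p. 59: "If `D` is Frobenius-slim, then … the image of [the element
`1 ∈ ℤ_{≥0} ⊆ 𝔽`] via any homomorphism of monoids `𝔽 → End(C^pl-bk_A → C)^bs-iso` … lies in `O^▷(-)`"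
(i.e. every component is a base-identity linear endomorphism) [cite: MochizukiFrdI2008, Prop. 3.3 (i) p.59].

PROOF-ONLY companion (no definitions, no instances) of `BaseCategoryTheoreticityDefs.lean` (seat
abc-iut-L1-t3); cell abc-iut, block F, seat abc-iut-f-045 (gen 4).  FACT-LIST row **F-0915**
`Prop33i_forward S A` (R7 TYPE-audit abc-iut-w5-d199: «no EXACT witness of the universal closure»).  The
decl quantifies over ARBITRARY operations `S : PreFrobenioidData C D` — an interface carrying `Base`, `Φ`,
`Div`, `deg_Fr` and the laws of Rem. 1.1.1 only, none of Def. 1.3; in particular nothing ties the category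
`C^pl-bk_A` of pull-back morphisms over `A` to the base slice `D_{Base A}` (Def. 1.3 (i)(c)), which is the
step of the printed proof (p. 60) that lets Frobenius-slimness of `D` act.  Linearity of the components is
automatic for every `S` (`PreFrobenioidData.prop33i_forward_isLinear`); base-identity is not:

WITNESS.  `D := SingleObj (Function.End ℚ)`, the one-object category on the monoid of ALL self-maps of
`ℚ`.  It is SLIM (`isSlim_singleObj_functionEnd_rat`: naturality of an automorphism `θ` of `D_⋆ → D`
against the constant maps `c_ω` reads `θ_o ∘ c_ω = c_ω ∘ θ_{o'}`, so every component fixes every `ω`),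
hence Frobenius-slim ([FrdI] Def. 3.1 (i) "every slim category is Frobenius-slim", tree
`IsSlim.isFrobeniusSlim`) — although `End_D(⋆)` contains the affine group of `ℚ`.  `C := SingleObj
(Function.End ℚ)ˣ` over `D` by the inclusion of units, with `Φ = 0`, `Div = 0`, `deg_Fr = 1`.  Conjugation
`t ↦ (φ ↦ φ⁻¹ t φ)` is an honest homomorphism `(Function.End ℚ)ˣ → End(C^pl-bk_⋆ → C)^bs-iso` (natural
in the arrows over `⋆`; components are units, hence base-isomorphisms), and the affine representation
`(a, n) ↦ (y ↦ n y + a)` is an honest homomorphism `𝔽 → (Function.End ℚ)ˣ`; their composite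
`f : 𝔽 → End(C^pl-bk_⋆ → C)^bs-iso` has `γ`-component at the pull-back morphism `id_⋆` equal to the
translation `y ↦ y + 1`, whose `Base` is that translation `≠ id`: NOT a base-identity endomorphism.
* `not_forall_prop33i_forward` — the universal closure of F-0915 (universe `0`) is FALSE.
So the row is admissible AT THE NAMED INSTANCE ONLY (R5): `PreFrobenioid.prop33i_forward_of_hom`
(`IsFrobenioid F`, Frobenius-slim `D`; `BaseIdentityPreStepsSlim.lean`) — untouched.  Refuted-closure ≠
refuted-paper (the missing input is exactly Def. 1.3 (i)(c)); a FACT row is an assumption label, not an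
endorsement; nothing here bears on [IUTchIII] Cor. 3.12.
-/

namespace Literature.AlgebraicGeometry.Frobenioids

open CategoryTheory

/-- The one-object category on the monoid `End(ℚ)` of ALL self-maps of `ℚ` is slim: a natural
automorphism `θ` of `D_⋆ → D` satisfies `θ_o ∘ c_ω = c_ω ∘ θ_{o'}` for the constant map `c_ω`, so every
component fixes every `ω ∈ ℚ` ("[Thus, every slim category is Frobenius-slim]", FrdI Def. 3.1 (i) p. 56,
is then `IsSlim.isFrobeniusSlim`). [cite: MochizukiFrdI2008, Def. 3.1 (i) p.56] -/
theorem isSlim_singleObj_functionEnd_rat : IsSlim (SingleObj (Function.End ℚ)) := by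
  refine ⟨fun A α => Iso.ext (NatTrans.ext (funext fun o => ?_))⟩
  show α.hom.app o = 𝟙 _
  rw [SingleObj.id_as_one]
  funext ω
  let c : Function.End ℚ := fun _ => ω
  let o' : Over A := Over.mk ((show o.left ⟶ o.left from c) ≫ o.hom)
  let k : o' ⟶ o := Over.homMk (show o.left ⟶ o.left from c) rfl
  have nat' : (show Function.End ℚ from α.hom.app o) * c =
      c * (show Function.End ℚ from α.hom.app o') := by
    have := α.hom.naturality k
    rw [SingleObj.comp_as_mul, SingleObj.comp_as_mul] at this
    exact this
  exact congrFun nat' ω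

/-- Units of a monoid `M` are isomorphisms of the one-object category `SingleObj M`. [folklore] -/
private theorem isIso_singleObj_of_unit {M : Type} [Monoid M] (u : Mˣ) :
    @IsIso (SingleObj M) _ (SingleObj.star M) (SingleObj.star M) (u : M) :=
  ⟨⟨((u⁻¹ : Mˣ) : M), by rw [SingleObj.comp_as_mul, Units.inv_mul, SingleObj.id_as_one],
    by rw [SingleObj.comp_as_mul, Units.mul_inv, SingleObj.id_as_one]⟩⟩

/-- FACT-LIST **F-0915**: the universal closure of `Prop33i_forward` (universe `0`) is FALSE.  Witness:
`D = SingleObj (Function.End ℚ)` (slim, hence Frobenius-slim), `C = SingleObj (Function.End ℚ)ˣ` over it by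
the units inclusion with `Φ = 0`, `deg_Fr = 1`, `A = ⋆`, the homomorphism `f = (conjugation along
pull-backs) ∘ (affine representation (a, n) ↦ (y ↦ n y + a))`, and the pull-back morphism `id_⋆`: the
`γ`-component is the translation `y ↦ y + 1`, not base-identity.  Instance of record (untouched):
`PreFrobenioid.prop33i_forward_of_hom`. [cite: MochizukiFrdI2008, Prop. 3.3 (i) p.59] -/
theorem not_forall_prop33i_forward :
    ¬ ∀ (C : Type) [Category.{0} C] (D : Type) [Category.{0} D] (S : PreFrobenioidData.{0} C D)
        (A : C), Prop33i_forward S A := by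
  intro h
  let S : PreFrobenioidData.{0} (SingleObj (Function.End ℚ)ˣ) (SingleObj (Function.End ℚ)) :=
    { base := SingleObj.mapHom (Function.End ℚ)ˣ (Function.End ℚ) (Units.coeHom (Function.End ℚ))
      Mon := fun _ => PUnit
      pull := fun _ => MonoidHom.id _
      pull_id := fun _ _ => rfl
      pull_comp := fun _ _ _ => rfl
      div := fun _ => PUnit.unit
      degFr := fun _ => 1
      div_id := fun _ => rfl
      div_comp := fun _ _ => rfl
      degFr_id := fun _ => rfl
      degFr_comp := fun _ _ => (mul_one 1).symm }
  let A := SingleObj.star (Function.End ℚ)ˣ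
  -- conjugating a unit along the pull-back morphisms: `𝒪 : (Function.End ℚ)ˣ → End(C^pl-bk_A → C)^bs-iso`
  let F : (Function.End ℚ)ˣ →* S.EndPlbkBsIso A :=
    { toFun := fun t =>
        { app := fun B φ _ => ((id φ : (Function.End ℚ)ˣ)⁻¹ * t * (id φ : (Function.End ℚ)ˣ) : (Function.End ℚ)ˣ)
          naturality := fun B B' φ hφ φ' hφ' g hg => by
            obtain rfl : A = B := Subsingleton.elim _ _
            obtain rfl : A = B' := Subsingleton.elim _ _
            rw [SingleObj.comp_as_mul] at hg
            rw [SingleObj.comp_as_mul, SingleObj.comp_as_mul, ← hg]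
            change ((id φ : (Function.End ℚ)ˣ)⁻¹ * t * (id φ : (Function.End ℚ)ˣ)) * (id g : (Function.End ℚ)ˣ) =
              (id g : (Function.End ℚ)ˣ) * (((id φ : (Function.End ℚ)ˣ) * (id g : (Function.End ℚ)ˣ))⁻¹ * t *
                ((id φ : (Function.End ℚ)ˣ) * (id g : (Function.End ℚ)ˣ)))
            simp only [mul_inv_rev, mul_assoc, mul_inv_cancel_left]
          isBaseIso := fun B φ _ => by
            obtain rfl : A = B := Subsingleton.elim _ _
            exact isIso_singleObj_of_unit ((id φ : (Function.End ℚ)ˣ)⁻¹ * t * (id φ : (Function.End ℚ)ˣ)) }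
      map_one' := PreFrobenioidData.EndPlbkBsIso.ext fun B φ hφ => by
        obtain rfl : A = B := Subsingleton.elim _ _
        change (id φ : (Function.End ℚ)ˣ)⁻¹ * 1 * (id φ : (Function.End ℚ)ˣ) = (1 : (Function.End ℚ)ˣ)
        rw [mul_one, inv_mul_cancel]
      map_mul' := fun t t' => PreFrobenioidData.EndPlbkBsIso.ext fun B φ hφ => by
        obtain rfl : A = B := Subsingleton.elim _ _
        change (id φ : (Function.End ℚ)ˣ)⁻¹ * (t * t') * (id φ : (Function.End ℚ)ˣ) =
          ((id φ : (Function.End ℚ)ˣ)⁻¹ * t * (id φ : (Function.End ℚ)ˣ)) *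
            ((id φ : (Function.End ℚ)ˣ)⁻¹ * t' * (id φ : (Function.End ℚ)ˣ))
        simp only [mul_assoc, mul_inv_cancel_left] }
  -- the affine representation `(a, n) ↦ (y ↦ n y + a)` of `𝔽`
  let ρ : StandardFrobenioid →* (Function.End ℚ)ˣ :=
    { toFun := fun x =>
        ⟨fun y : ℚ => ((x.degFr : ℕ) : ℚ) * y + ((Multiplicative.toAdd x.div : ℕ) : ℚ),
         fun y : ℚ => (y - ((Multiplicative.toAdd x.div : ℕ) : ℚ)) / ((x.degFr : ℕ) : ℚ),
         by
          funext y
          show ((x.degFr : ℕ) : ℚ) * ((y - ((Multiplicative.toAdd x.div : ℕ) : ℚ)) / ((x.degFr : ℕ) : ℚ)) +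
            ((Multiplicative.toAdd x.div : ℕ) : ℚ) = y
          rw [mul_div_cancel₀ _ (by exact_mod_cast x.degFr.ne_zero), sub_add_cancel],
         by
          funext y
          show (((x.degFr : ℕ) : ℚ) * y + ((Multiplicative.toAdd x.div : ℕ) : ℚ) -
            ((Multiplicative.toAdd x.div : ℕ) : ℚ)) / ((x.degFr : ℕ) : ℚ) = y
          rw [add_sub_cancel_right, mul_div_cancel_left₀ _ (by exact_mod_cast x.degFr.ne_zero)]⟩
      map_one' := by
        apply Units.ext
        funext y
        show (((1 : ℕ+) : ℕ) : ℚ) * y + ((Multiplicative.toAdd (1 : Multiplicative ℕ) : ℕ) : ℚ) = y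
        rw [PNat.one_coe, Nat.cast_one, one_mul, toAdd_one, Nat.cast_zero, add_zero]
      map_mul' := fun x x' => by
        apply Units.ext
        funext y
        show (((x.degFr * x'.degFr : ℕ+) : ℕ) : ℚ) * y +
            ((Multiplicative.toAdd (x.div * x'.div ^ (x.degFr : ℕ)) : ℕ) : ℚ) =
          ((x.degFr : ℕ) : ℚ) * (((x'.degFr : ℕ) : ℚ) * y + ((Multiplicative.toAdd x'.div : ℕ) : ℚ)) +
            ((Multiplicative.toAdd x.div : ℕ) : ℚ)
        rw [PNat.mul_coe, toAdd_mul, toAdd_pow, smul_eq_mul]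
        push_cast
        ring }
  have hpb := S.isPullbackMorphism_id A
  obtain ⟨hb, -⟩ := h (SingleObj (Function.End ℚ)ˣ) (SingleObj (Function.End ℚ)) S A isSlim_singleObj_functionEnd_rat.isFrobeniusSlim
    (F.comp ρ) (𝟙 A) hpb
  -- the `γ`-component at `id_A` is the translation `y ↦ y + 1`; `hb` says it is base-identity
  have hx : ((F.comp ρ) StandardFrobenioid.gen).app (𝟙 A) hpb =
      (show A ⟶ A from (ρ StandardFrobenioid.gen : (Function.End ℚ)ˣ)) := by
    change (id (𝟙 A) : (Function.End ℚ)ˣ)⁻¹ * ρ StandardFrobenioid.gen * (id (𝟙 A) : (Function.End ℚ)ˣ) = ρ StandardFrobenioid.gen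
    simp only [SingleObj.id_as_one, id, inv_one, one_mul, mul_one]
  rw [hx] at hb
  have hb' : ((ρ StandardFrobenioid.gen : (Function.End ℚ)ˣ) : (Function.End ℚ)) = 1 := hb
  have h0 := congrFun hb' 0
  revert h0
  show ((((StandardFrobenioid.gen.degFr : ℕ+) : ℕ) : ℚ) * 0 +
      ((Multiplicative.toAdd (Multiplicative.ofAdd (1 : ℕ)) : ℕ) : ℚ) = 0) → False
  rw [mul_zero, zero_add, toAdd_ofAdd, Nat.cast_one]
  exact one_ne_zero

end Literature.AlgebraicGeometry.Frobenioids
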